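import Summits.QuantumFields.BalabanUV.T4Continuum.Support.T4TrajectoryDensityDressedLoop

/-!
# `T4Continuum.T4TrajectoryDensityFreshBudget` — the SCALAR BOOTSTRAP of the (w2-obs) clause: the undressed fresh profile is
# summable down the tower (K-free) and OBS-SUM closes on itself under a K-free smallness of the source strength (companion of
# `T4TrajectoryDensityFresh`, which supplies the function-level half: exact recentring + the fresh supplier) (cell
# `pub-balaban`, sub-cell `t4`, spine estimate NE1′ (node O3b/H2), lineage t4-ne1p-p1 = PROVER seat P1, technique
# «RG-trajectory comparison», generation 22; tree target `Summits/QuantumFields/BalabanUV/T4Continuum/Support/`; ADDITIVE —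
# imports part 2 `T4TrajectoryDensityDressedLoop` ONLY (independent of `T4TrajectoryDensityFresh`), modifies nothing)

HONEST FRAMING.  Finite four-torus, rung (B)+1 only — NOT infinite volume, NOT a mass gap, NOT the Clay problem, NOT summit
progress.  «continuum YM on T⁴ ⇐ BetaPertH ∧ nine spine estimates (0/9 proved); BetaPertH ⇐ (D1) ∧ (D4) ∧ CAP+tail; G-an2-4
gates asym, D1 and NE2/3/4».  ABSOLUTE RULE honoured: [folklore] real-number bookkeeping only (geometric series, one
induction), 0 sorry, 0 citations; NOTHING is said about Bałaban's densities or the cell's D-terms — every rate below is a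
HYPOTHESIS SHAPE of the cell's format (record `t4/T4-EST-NE1p-P1.md` §4), never asserted.

CONTENTS (§11 of the (w2)-split; §1–§4 = part 1, §5–§8 = part 2, §9–§10 = `T4TrajectoryDensityFresh`).  The function-level
half shows that the oscillation budget `s₁ k` of the dressed capstone's `hP` is the FRESH-FLUCTUATION RESPONSE of the live
carried terms, `s₁ k = m·Σ_i (4A_i/r_i)·δ_i` (`m = ‖c‖ ∝ |μ|`, `A_i`/`r_i` the current slice size/radius of live term `i`,
`δ_i` its fresh-pair defect).  Here: `freshBudget_le` (one met step: current sizes = undressed sizes × the accumulated step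
factor `E`, radius floor `r_*` ⟹ `s₁ ≤ m·E·(4/r_*)·Σ_i Ā_i δ_i`); `freshProfile_sum_le` (the UNDRESSED profile
`Σ_{k<K} Σ_{j≤k} N₀Λ^{k−j}·c_δψ^{k−j}·Âτ^{K−j} ≤ N₀c_δÂ·(1−ρ)⁻¹(1−τ)⁻¹` under the O-G2 strict product `Λψτ ≤ ρ < 1`, `0 ≤ τ < 1`
— positional count × fresh defect of transport-rate type (I4′) × birth (I3); K-FREE); `obsSum_of_bootstrap` (the
self-consistent law `s₁ k ≤ m·e^{3(S₀ + Σ_{i<k} s₁ i)}·γ k`, `Σγ ≤ Γ` K-free, closes under `m·e^{3(S₀+1)}·Γ ≤ 1`: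
`Σ_{k<K} s₁ k ≤ 1` for EVERY `K` = OBS-SUM with `S₁ = 1`); `freshBudget_step_le` (the per-step budget, for the capstone's
`hs`); `size_uniform_of_bootstrap` (part 2 §8 `size_uniform_of_summable` fed by it: K-UNIFORM sizes `≤ A_0·e^{3(S₀+1)}`); a
decided numeric sanity check; and (§12, v1.1) THE CONVERSE BOOKKEEPING: without the strict product (`1 ≤ Λψτ`) the same
profile is `≥ N₀c_δÂτ·K` — NOT K-free (`freshProfile_sum_ge_linear`, `freshProfile_not_Kfree`) — and the lineage's own rate
table decides which fresh rate qualifies (`freshRate_table`, by name from `T4BirthChartTransport` §3: current chart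
`ψ = 1` ⟹ `Λψτ = L`, raw birth chart `ψ = L⁻¹` ⟹ `Λψτ = 1`, transverse/gauge-quotient `ψ = L⁻²` ⟹ `Λψτ = L⁻¹ < 1`): the
(T-⊥)/(I4′) TRANSVERSE reading of the fresh-pair defect is LOAD-BEARING for the μ-uniform clause, the raw readings are
not enough.  `S₀` = the summed ACTION oscillation at the family's met steps — binder (w2-act)/(w4), NOT
supplied here; the smallness is a K-FREE condition on the source strength — binder (w6).  Part 2's `source_bound_noContraction`
(sup-form feedback ⟹ source strength shrinking with `K`) is thereby an artefact of the crude supplier of part 2 §5, not an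
obstruction to the μ-uniform clause.
-/

namespace Summit.QuantumFields.BalabanUV.T4Continuum.T4TrajectoryDensityDressed

open Literature.MathematicalPhysics.QuantumFieldTheory.Balaban1983to89

noncomputable section

/-! ## §11 The scalar bootstrap: the fresh profile is summable down the tower, and OBS-SUM closes on itself [folklore] -/

section Bootstrap

open Finset

/-- Exponent bookkeeping `τ^{K−j} = τ^{K−k}·τ^{k−j}` for `j ≤ k ≤ K`. [folklore] -/
theorem pow_sub_split {τ : ℝ} {j k K : ℕ} (hjk : j ≤ k) (hkK : k ≤ K) :
    τ ^ (K - j) = τ ^ (K - k) * τ ^ (k - j) := by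
  rw [← pow_add]
  congr 1
  omega

/-- **THE UNDRESSED FRESH PROFILE IS SUMMABLE DOWN THE TOWER, K-FREE.**  Per step `k < K`, the families of birth scale
`j ≤ k` live at a cube number `≤ N₀·Λ^{k−j}` (positional count), respond to a fresh pair by `≤ c_δ·ψ^{k−j}` per unit size
(fresh defect of (I4′) type — the transport rate) and were born with size `≤ Â·τ^{K−j}` ((I3)); under the O-G2 strict
product `Λψτ ≤ ρ < 1` and `0 ≤ τ < 1` the double sum is at most `N₀·c_δ·Â·(1−ρ)⁻¹·(1−τ)⁻¹`, INDEPENDENT OF `K`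
(inner sum = geometric in the age by `T4BlockTransport.sum_pow_sub_le_inv`, outer = the source-decay profile
`Σ_{k<K} τ^{K−k} ≤ (1−τ)⁻¹` by `T4TrajectoryComparison.sum_pow_rev_le_inv`). [folklore] -/
theorem freshProfile_sum_le {N₀ cδ Ahat Λ ψ τ ρ : ℝ} (hN₀ : 0 ≤ N₀) (hcδ : 0 ≤ cδ) (hAhat : 0 ≤ Ahat)
    (hΛ : 0 ≤ Λ) (hψ : 0 ≤ ψ) (hτ0 : 0 ≤ τ) (hτ1 : τ < 1) (hρ1 : ρ < 1) (hprod : Λ * ψ * τ ≤ ρ) (K : ℕ) :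
    ∑ k ∈ range K, ∑ j ∈ range (k + 1), N₀ * Λ ^ (k - j) * (cδ * ψ ^ (k - j)) * (Ahat * τ ^ (K - j)) ≤
      N₀ * cδ * Ahat * ((1 - ρ)⁻¹ * (1 - τ)⁻¹) := by
  have hρ0 : 0 ≤ ρ := le_trans (by positivity) hprod
  have hC : 0 ≤ N₀ * cδ * Ahat := by positivity
  have hinner : ∀ k ∈ range K,
      ∑ j ∈ range (k + 1), N₀ * Λ ^ (k - j) * (cδ * ψ ^ (k - j)) * (Ahat * τ ^ (K - j)) ≤
        N₀ * cδ * Ahat * (1 - ρ)⁻¹ * τ ^ (K - k) := by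
    intro k hk
    have hkK : k ≤ K := (mem_range.mp hk).le
    calc ∑ j ∈ range (k + 1), N₀ * Λ ^ (k - j) * (cδ * ψ ^ (k - j)) * (Ahat * τ ^ (K - j))
        = ∑ j ∈ range (k + 1), N₀ * cδ * Ahat * τ ^ (K - k) * (Λ * ψ * τ) ^ (k - j) := by
          refine sum_congr rfl fun j hj => ?_
          rw [pow_sub_split (mem_range_succ_iff.mp hj) hkK, mul_pow, mul_pow]
          ring
      _ ≤ ∑ j ∈ range (k + 1), N₀ * cδ * Ahat * τ ^ (K - k) * ρ ^ (k - j) := by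
          refine sum_le_sum fun j _ => mul_le_mul_of_nonneg_left
            (pow_le_pow_left₀ (by positivity) hprod _) (by positivity)
      _ = N₀ * cδ * Ahat * τ ^ (K - k) * ∑ j ∈ range (k + 1), ρ ^ (k - j) := by rw [mul_sum]
      _ ≤ N₀ * cδ * Ahat * τ ^ (K - k) * (1 - ρ)⁻¹ :=
          mul_le_mul_of_nonneg_left (T4BlockTransport.sum_pow_sub_le_inv hρ0 hρ1 k) (by positivity)
      _ = N₀ * cδ * Ahat * (1 - ρ)⁻¹ * τ ^ (K - k) := by ring
  calc ∑ k ∈ range K, ∑ j ∈ range (k + 1), N₀ * Λ ^ (k - j) * (cδ * ψ ^ (k - j)) * (Ahat * τ ^ (K - j))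
      ≤ ∑ k ∈ range K, N₀ * cδ * Ahat * (1 - ρ)⁻¹ * τ ^ (K - k) := sum_le_sum hinner
    _ = N₀ * cδ * Ahat * (1 - ρ)⁻¹ * ∑ k ∈ range K, τ ^ (K - k) := by rw [mul_sum]
    _ ≤ N₀ * cδ * Ahat * (1 - ρ)⁻¹ * (1 - τ)⁻¹ :=
        mul_le_mul_of_nonneg_left (T4TrajectoryComparison.sum_pow_rev_le_inv hτ0 hτ1 K)
          (mul_nonneg hC (inv_nonneg.mpr (by linarith)))
    _ = N₀ * cδ * Ahat * ((1 - ρ)⁻¹ * (1 - τ)⁻¹) := by ring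

/-- **FROM THE FRESH SUPPLIER TO THE SELF-CONSISTENT LAW** (one met step, scalar).  If the step-`k` budget is the fresh
sum `s₁ = m·Σ_i 4 A_i / r_i · δ_i` (`m = ‖c‖ ≥ 0`), every live term's current slice size is its undressed profile size
times the accumulated step factor, `A_i ≤ Ā_i·E` (part 2 §8 `size_le_of_rec`: `E = e^{3 Σ_{met i<k}(s⁰+s₁)}`), the radii
have a floor `r_* ≤ r_i`, and `δ_i, Ā_i ≥ 0`, then `s₁ ≤ m·E·(4/r_*)·Σ_i Ā_i·δ_i`. [folklore] -/
theorem freshBudget_le {ι : Type*} (S : Finset ι) {A r δ Abar : ι → ℝ} {m E rstar s₁ : ℝ} (hm : 0 ≤ m) (hE : 0 ≤ E)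
    (hrstar : 0 < rstar) (hr : ∀ i ∈ S, rstar ≤ r i) (hA : ∀ i ∈ S, A i ≤ Abar i * E)
    (hAbar : ∀ i ∈ S, 0 ≤ Abar i) (hδ : ∀ i ∈ S, 0 ≤ δ i)
    (hs₁ : s₁ = m * ∑ i ∈ S, 4 * A i / r i * δ i) :
    s₁ ≤ m * E * (4 / rstar) * ∑ i ∈ S, Abar i * δ i := by
  rw [hs₁, mul_sum, mul_sum]
  refine sum_le_sum fun i hi => ?_
  have hri : 0 < r i := lt_of_lt_of_le hrstar (hr i hi)
  have h1 : 4 * A i / r i ≤ 4 * (Abar i * E) / rstar :=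
    calc 4 * A i / r i ≤ 4 * (Abar i * E) / r i :=
          div_le_div_of_nonneg_right (by linarith [hA i hi]) hri.le
      _ ≤ 4 * (Abar i * E) / rstar :=
          div_le_div_of_nonneg_left (by have := hAbar i hi; positivity) hrstar (hr i hi)
  calc m * (4 * A i / r i * δ i) ≤ m * (4 * (Abar i * E) / rstar * δ i) :=
        mul_le_mul_of_nonneg_left (mul_le_mul_of_nonneg_right h1 (hδ i hi)) hm
    _ = m * E * (4 / rstar) * (Abar i * δ i) := by ring

/-- **OBS-SUM BY BOOTSTRAP.**  Budgets obeying the self-consistent law `s₁ k ≤ m·e^{3(S₀ + Σ_{i<k} s₁ i)}·γ k` with a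
K-FREE summable profile `Σ_{k<K} γ k ≤ Γ` (all `K`), `γ ≥ 0`, `m ≥ 0`, satisfy, under the K-FREE smallness
`m·e^{3(S₀+1)}·Γ ≤ 1` of the source strength: `Σ_{k<K} s₁ k ≤ m·e^{3(S₀+1)}·Σ_{k<K} γ k ≤ 1` for EVERY `K` — OBS-SUM with
`S₁ = 1` (induction on `K`: the partial sum so far is `≤ 1`, so the next step factor is `≤ e^{3(S₀+1)}`). [folklore] -/
theorem obsSum_of_bootstrap {s₁ γ : ℕ → ℝ} {m S₀ Γ : ℝ} (hm : 0 ≤ m) (hγ : ∀ k, 0 ≤ γ k)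
    (hΓ : ∀ K, ∑ k ∈ range K, γ k ≤ Γ)
    (hlaw : ∀ k, s₁ k ≤ m * Real.exp (3 * (S₀ + ∑ i ∈ range k, s₁ i)) * γ k)
    (hsmall : m * Real.exp (3 * (S₀ + 1)) * Γ ≤ 1) :
    ∀ K, ∑ k ∈ range K, s₁ k ≤ m * Real.exp (3 * (S₀ + 1)) * ∑ k ∈ range K, γ k ∧ ∑ k ∈ range K, s₁ k ≤ 1 := by
  have hM : 0 ≤ m * Real.exp (3 * (S₀ + 1)) := mul_nonneg hm (Real.exp_pos _).le
  have hcap : ∀ K, m * Real.exp (3 * (S₀ + 1)) * ∑ k ∈ range K, γ k ≤ 1 := fun K =>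
    (mul_le_mul_of_nonneg_left (hΓ K) hM).trans hsmall
  intro K
  induction K with
  | zero => exact ⟨by simp, by simp⟩
  | succ K ih =>
    have hP : ∑ i ∈ range K, s₁ i ≤ 1 := ih.2
    have hstep : s₁ K ≤ m * Real.exp (3 * (S₀ + 1)) * γ K :=
      (hlaw K).trans (mul_le_mul_of_nonneg_right
        (mul_le_mul_of_nonneg_left (Real.exp_le_exp.mpr (by linarith)) hm) (hγ K))
    have hsum : ∑ k ∈ range (K + 1), s₁ k ≤ m * Real.exp (3 * (S₀ + 1)) * ∑ k ∈ range (K + 1), γ k := by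
      rw [sum_range_succ, sum_range_succ, mul_add]
      exact add_le_add ih.1 hstep
    exact ⟨hsum, hsum.trans (hcap (K + 1))⟩

/-- **THE PER-STEP BUDGET UNDER THE BOOTSTRAP.**  Under the same law and smallness every single budget obeys
`s₁ k ≤ m·e^{3(S₀+1)}·γ k`; so the capstone's `hs : s⁰ k + s₁ k ≤ 1` holds as soon as `m·e^{3(S₀+1)}·γ k ≤ 1 − s⁰ k`
— again a K-FREE condition on the source strength. [folklore] -/
theorem freshBudget_step_le {s₁ γ : ℕ → ℝ} {m S₀ Γ : ℝ} (hm : 0 ≤ m) (hγ : ∀ k, 0 ≤ γ k)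
    (hΓ : ∀ K, ∑ k ∈ range K, γ k ≤ Γ)
    (hlaw : ∀ k, s₁ k ≤ m * Real.exp (3 * (S₀ + ∑ i ∈ range k, s₁ i)) * γ k)
    (hsmall : m * Real.exp (3 * (S₀ + 1)) * Γ ≤ 1) (k : ℕ) :
    s₁ k ≤ m * Real.exp (3 * (S₀ + 1)) * γ k :=
  (hlaw k).trans (mul_le_mul_of_nonneg_right
    (mul_le_mul_of_nonneg_left (Real.exp_le_exp.mpr (by linarith [(obsSum_of_bootstrap hm hγ hΓ hlaw hsmall k).2]))
      hm) (hγ k))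

/-- **K-UNIFORM SIZES OF THE OBSERVABLE-ATTACHED TERMS** (part 2 §8 fed by the bootstrap): with the action
oscillations summable at the family's met steps (`Σ_{i<k} s⁰ i ≤ S₀`, binder (w2-act)/(w4)) and OBS-SUM from
`obsSum_of_bootstrap`, a carried size obeying `A_{k+1} ≤ e^{3(s⁰_k + s₁_k)}·A_k` stays `≤ A_0·e^{3(S₀+1)}` for ALL `k`
(`size_uniform_of_summable` by name). [folklore] -/
theorem size_uniform_of_bootstrap {A s₀ s₁ γ : ℕ → ℝ} {m S₀ Γ : ℝ} (hA : ∀ k, 0 ≤ A k)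
    (hrec : ∀ k, A (k + 1) ≤ Real.exp (3 * (s₀ k + s₁ k)) * A k) (hS₀ : ∀ k, ∑ i ∈ range k, s₀ i ≤ S₀)
    (hm : 0 ≤ m) (hγ : ∀ k, 0 ≤ γ k) (hΓ : ∀ K, ∑ k ∈ range K, γ k ≤ Γ)
    (hlaw : ∀ k, s₁ k ≤ m * Real.exp (3 * (S₀ + ∑ i ∈ range k, s₁ i)) * γ k)
    (hsmall : m * Real.exp (3 * (S₀ + 1)) * Γ ≤ 1) :
    ∀ k, A k ≤ A 0 * Real.exp (3 * (S₀ + 1)) :=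
  size_uniform_of_summable (s := fun k => s₀ k + s₁ k) hA hrec fun k => by
    rw [sum_add_distrib]
    exact add_le_add (hS₀ k) (obsSum_of_bootstrap hm hγ hΓ hlaw hsmall k).2

/-- DECIDED SANITY (numbers, not adjectives): with `S₀ = 0`, `Γ = 1/64` the smallness asks `m ≤ 64·e^{−3}`; `m = 3`
qualifies (`3·e³ ≤ 64` since `e < 2.7182818286`), `m = 4` does not (`4·e³ > 64` since `e > 2.7182818283`). [folklore] -/
example : (3 : ℝ) * Real.exp (3 * (0 + 1)) * (1 / 64) ≤ 1 ∧ ¬ ((4 : ℝ) * Real.exp (3 * (0 + 1)) * (1 / 64) ≤ 1) := by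
  have h3 : Real.exp (3 * (0 + 1)) = Real.exp 1 ^ 3 := by
    rw [← Real.exp_nat_mul]; norm_num
  have hup : Real.exp 1 ^ 3 < (2.7182818286 : ℝ) ^ 3 :=
    pow_lt_pow_left₀ Real.exp_one_lt_d9 (Real.exp_pos 1).le three_ne_zero
  have hlo : (2.7182818283 : ℝ) ^ 3 < Real.exp 1 ^ 3 :=
    pow_lt_pow_left₀ Real.exp_one_gt_d9 (by norm_num) three_ne_zero
  rw [h3]
  constructor
  · nlinarith [hup]
  · nlinarith [hlo]

end Bootstrap

/-! ## §12 (v1.1) The converse bookkeeping: no strict product, no K-free profile — the transverse fresh rate is load-bearing [folklore] -/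

section Converse

open Finset

/-- **WITHOUT THE STRICT PRODUCT THE FRESH PROFILE GROWS AT LEAST LINEARLY IN `K`.**  If `1 ≤ Λψτ` (and `0 ≤ τ`), the
double sum of `freshProfile_sum_le` is `≥ N₀·c_δ·Â·τ·K`: already its last row `k = K − 1` has `K` terms, each
`N₀c_δÂ·τ·(Λψτ)^{K−1−j} ≥ N₀c_δÂ·τ`. [folklore] -/
theorem freshProfile_sum_ge_linear {N₀ cδ Ahat Λ ψ τ : ℝ} (hN₀ : 0 ≤ N₀) (hcδ : 0 ≤ cδ) (hAhat : 0 ≤ Ahat)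
    (hΛ : 0 ≤ Λ) (hψ : 0 ≤ ψ) (hτ0 : 0 ≤ τ) (hprod : 1 ≤ Λ * ψ * τ) (K : ℕ) :
    N₀ * cδ * Ahat * τ * (K : ℝ) ≤
      ∑ k ∈ range K, ∑ j ∈ range (k + 1), N₀ * Λ ^ (k - j) * (cδ * ψ ^ (k - j)) * (Ahat * τ ^ (K - j)) := by
  rcases Nat.eq_zero_or_pos K with rfl | hK
  · simp
  · obtain ⟨K', rfl⟩ : ∃ K', K = K' + 1 := ⟨K - 1, by omega⟩
    have hterm : ∀ k j : ℕ, 0 ≤ N₀ * Λ ^ (k - j) * (cδ * ψ ^ (k - j)) * (Ahat * τ ^ (K' + 1 - j)) :=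
      fun k j => by positivity
    calc N₀ * cδ * Ahat * τ * ((K' + 1 : ℕ) : ℝ) = ∑ _j ∈ range (K' + 1), N₀ * cδ * Ahat * τ := by
          rw [sum_const, card_range, nsmul_eq_mul]
          push_cast
          ring
      _ ≤ ∑ j ∈ range (K' + 1), N₀ * Λ ^ (K' - j) * (cδ * ψ ^ (K' - j)) * (Ahat * τ ^ (K' + 1 - j)) := by
          refine sum_le_sum fun j hj => ?_
          have hjK : j ≤ K' := mem_range_succ_iff.mp hj
          have e : τ ^ (K' + 1 - j) = τ * τ ^ (K' - j) := by
            rw [show K' + 1 - j = (K' - j) + 1 by omega, pow_succ']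
          have h1 : 1 ≤ (Λ * ψ * τ) ^ (K' - j) := one_le_pow₀ hprod
          calc N₀ * cδ * Ahat * τ = N₀ * cδ * Ahat * τ * 1 := by ring
            _ ≤ N₀ * cδ * Ahat * τ * (Λ * ψ * τ) ^ (K' - j) := mul_le_mul_of_nonneg_left h1 (by positivity)
            _ = N₀ * Λ ^ (K' - j) * (cδ * ψ ^ (K' - j)) * (Ahat * τ ^ (K' + 1 - j)) := by
                rw [e, mul_pow, mul_pow]
                ring
      _ ≤ ∑ k ∈ range (K' + 1), ∑ j ∈ range (k + 1), N₀ * Λ ^ (k - j) * (cδ * ψ ^ (k - j)) * (Ahat * τ ^ (K' + 1 - j)) :=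
          single_le_sum (f := fun k => ∑ j ∈ range (k + 1), N₀ * Λ ^ (k - j) * (cδ * ψ ^ (k - j)) * (Ahat * τ ^ (K' + 1 - j)))
            (fun k _ => sum_nonneg fun j _ => hterm k j) (self_mem_range_succ K')

/-- **HENCE NOT K-FREE**: with `N₀c_δÂτ > 0` and `1 ≤ Λψτ` no `Γ` bounds the profile for all `K` — the hypothesis `hΓ` of
`obsSum_of_bootstrap` is then UNAVAILABLE from this profile (compare part 2's `source_bound_noContraction`: there the full
sizes were charged; here the fresh response is charged but read without the transverse gain). [folklore] -/
theorem freshProfile_not_Kfree {N₀ cδ Ahat Λ ψ τ : ℝ} (hN₀ : 0 ≤ N₀) (hcδ : 0 ≤ cδ) (hAhat : 0 ≤ Ahat)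
    (hΛ : 0 ≤ Λ) (hψ : 0 ≤ ψ) (hτ0 : 0 ≤ τ) (hprod : 1 ≤ Λ * ψ * τ) (hpos : 0 < N₀ * cδ * Ahat * τ) :
    ¬ ∃ Γ : ℝ, ∀ K : ℕ,
      ∑ k ∈ range K, ∑ j ∈ range (k + 1), N₀ * Λ ^ (k - j) * (cδ * ψ ^ (k - j)) * (Ahat * τ ^ (K - j)) ≤ Γ := by
  rintro ⟨Γ, hΓ⟩
  obtain ⟨K, hK⟩ := exists_nat_gt (Γ / (N₀ * cδ * Ahat * τ))
  have hle := (freshProfile_sum_ge_linear hN₀ hcδ hAhat hΛ hψ hτ0 hprod K).trans (hΓ K)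
  have hlt : Γ < N₀ * cδ * Ahat * τ * (K : ℝ) := by
    rw [div_lt_iff₀ hpos] at hK
    linarith
  linarith

/-- **THE LINEAGE'S RATE TABLE DECIDES WHICH FRESH RATE QUALIFIES** (`T4BirthChartTransport` §3 BY NAME; `Λ = L⁴`,
`τ = θ₁ = L⁻³`, `L > 1`): fresh-pair defect read in the CURRENT chart (`ψ = 1`, no gain): `Λψτ = L ≥ 1` — not K-free;
read RAW in the birth chart (`ψ = L⁻¹`, `product_raw`): `Λψτ = 1` — not K-free (linear growth); read TRANSVERSALLY modulo
gauge (`ψ = L⁻²`, `product_perp`): `Λψτ = L⁻¹ < 1` — K-free by `freshProfile_sum_le`.  So for the μ-uniform clause the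
(T-⊥)/(I4′) transverse reading of the fresh defect is LOAD-BEARING — the same input the booking `TransportsFrom φ = L⁻²`
needs; nothing of it is printed or asserted here. [folklore] -/
theorem freshRate_table {L : ℝ} (hL : 1 < L) :
    1 ≤ L ^ 4 * 1 * L⁻¹ ^ 3 ∧ 1 ≤ L ^ 4 * L⁻¹ * L⁻¹ ^ 3 ∧ L ^ 4 * (L ^ 2)⁻¹ * L⁻¹ ^ 3 < 1 := by
  have hL0 : L ≠ 0 := by positivity
  rw [T4BirthChartTransport.product_noGain hL0, T4BirthChartTransport.product_raw hL0,
    T4BirthChartTransport.product_perp hL0]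
  exact ⟨hL.le, le_rfl, inv_lt_one_of_one_lt₀ hL⟩

end Converse

end

end Summit.QuantumFields.BalabanUV.T4Continuum.T4TrajectoryDensityDressed
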